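import Summits.NavierStokesRegularity.NavierStokesRegularity.Theorems.PlaneEnergyCeilingPlanarEnergyAPrioriSmallDataInequalities
import HarnessLib

/-!
# Small planar data: the bootstrap, II — slack beyond a base time and closedness

Route `PlaneEnergyCeiling`, crux `PlanarEnergyAPriori` (stmt-NavierStokesRegularity-16855), small-data
corner, third tool file. Abstract setting: a continuous field `v` on `ℝ × ℝ³` (`ν = 1`), jointly
measurable, bounded by `D`, with planar energies bounded by `X_ap²` on every slice (a priori, crude),
which solves the Oseen integral equation `v(t) = e^{(t−t₀)Δ}v(t₀) − B_{t₀}(v,v)(t)` from every base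
time `0 ≤ t₀ < t ≤ S₁`. **Theorem (`planar_small_propagation`).** There are absolute `ε* > 0` and
`c* > 0` such that if the initial slice has planar energies `≤ ε²` with `0 < ε ≤ ε*`, then every slice
`v(t)`, `0 < t ≤ S₁`, has planar energies `≤ (2ε)²` and `√t ‖v(t)‖_∞ ≤ c*`.

Proof (continuity method on the two scale-invariant quantities `X(t) = sup_planes ‖v(t)‖_{L²}` and
`Φ(t) = √t ‖v(t)‖_∞`): with the inequalities of `SmallDataInequalities.lean` from the base time `0`,
the bounds `X ≤ 2ε`, `Φ ≤ η` on `(0, τ]` improve themselves to `X ≤ 3ε/2`, `Φ ≤ η/2`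
(`improve_planar`, `improve_sup`; the time integrals are `∫₀ᵗ (t−s)^{-1/2}s^{-1/2} ds ≤ 4√2` and
`∫₀ᵗ (const + (t−s)^{-1/2}) ds`); from the base time `τ` with the crude bounds `D`, `X_ap` they
persist a little beyond `τ` (`slack`); and they pass to limits `τ' ↑ τ` by Fatou and continuity
(`closed`); the first exit time therefore does not exist.

## References

* G. Koch, N. Nadirashvili, G. Seregin, V. Šverák, Acta Math. 203 (2009), §4 (arXiv:0709.3599).
  [KochNadirashviliSereginSverak2009]
* T. Kato, *Strong `L^p` solutions of the Navier–Stokes equation in `ℝ^m`*, Math. Z. 187 (1984)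
  (the small-data continuity method). [Kato1984]
-/

noncomputable section

-- single-conjunct summit: `Summit.<Summit>.<Problem>` repeats the name by the D-0017 layout
set_option linter.dupNamespace false

namespace Summit.NavierStokesRegularity.NavierStokesRegularity.Theorems.PlanarEnergyAPriori.SmallData

open MeasureTheory Set Function Filter Topology TopologicalSpace Metric WithLp
open scoped NNReal ENNReal
open Literature.Analysis Literature.Analysis.FluidPDE Literature.Analysis.FunctionSpaces

section Setting

variable {v : ℝ → EuclideanSpace ℝ (Fin 3) → EuclideanSpace ℝ (Fin 3)}

/-! ### Slack: the bounds persist a little beyond a base time -/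

/-- **Slack from a positive base time.** With `C₁` as in `planarEnergy_le_of_oseenRepr`: if `v` is
jointly measurable with continuous slices, `‖v‖ ≤ D` and the planar energies are `≤ X_ap²` on all
slices (crude a priori bounds), the Oseen representation holds from the base time `τ > 0` up to `S₁`,
and at the base time `v(τ)` has planar energies `≤ (3ε/2)²` and `‖v(τ)‖ ≤ η/(2√τ)`, then for some
`δ > 0` the bounds "planar energies `≤ (2ε)²`, `√t ‖v(t)‖ ≤ η`" hold for `τ < t ≤ τ + δ`, `t ≤ S₁`
(heat flow: planar contraction and `L^∞` contraction; Duhamel term: `2C₁ D X_ap √(t−τ)` and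
`2C₀ D² √(t−τ)`). [cite: KochNadirashviliSereginSverak2009, §4 p. 8] -/
theorem slack_pos {C₁ : ℝ} (hC₁ : 0 < C₁)
    (hC₁spec : ∀ {w : ℝ → EuclideanSpace ℝ (Fin 3) → EuclideanSpace ℝ (Fin 3)},
      Measurable (uncurry w) → (∀ s, Continuous (w s)) → ∀ {t₀ t : ℝ}, t₀ < t →
      (∀ x, w t x = UnboundedOperators.heatExtension (w t₀) (t - t₀) x - oseenDuhamel 1 t₀ w w t x) →
      ∀ {χ₀ : ℝ}, 0 ≤ χ₀ →
      (∀ (R : EuclideanSpace ℝ (Fin 3) ≃ₗᵢ[ℝ] EuclideanSpace ℝ (Fin 3)) (c : ℝ),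
        ∫⁻ y : EuclideanSpace ℝ (Fin 2), ‖w t₀ (R (toLp 2 ![y 0, y 1, c]))‖ₑ ^ 2 ≤ ENNReal.ofReal (χ₀ ^ 2)) →
      ∀ {χ ψ : ℝ → ℝ}, (∀ s ∈ Ioo t₀ t, 0 ≤ χ s) →
      (∀ s ∈ Ioo t₀ t, ∀ (R : EuclideanSpace ℝ (Fin 3) ≃ₗᵢ[ℝ] EuclideanSpace ℝ (Fin 3)) (c : ℝ),
        ∫⁻ y : EuclideanSpace ℝ (Fin 2), ‖w s (R (toLp 2 ![y 0, y 1, c]))‖ₑ ^ 2 ≤ ENNReal.ofReal (χ s ^ 2)) →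
      (∀ s ∈ Ioo t₀ t, ∀ x, ‖w s x‖ ≤ ψ s) →
      IntegrableOn (fun s => (t - s) ^ (-(1 / 2 : ℝ)) * (ψ s * χ s)) (Ioo t₀ t) →
      ∀ (R : EuclideanSpace ℝ (Fin 3) ≃ₗᵢ[ℝ] EuclideanSpace ℝ (Fin 3)) (c : ℝ),
        ∫⁻ y : EuclideanSpace ℝ (Fin 2), ‖w t (R (toLp 2 ![y 0, y 1, c]))‖ₑ ^ 2 ≤
          ENNReal.ofReal ((χ₀ + C₁ * ∫ s in Ioo t₀ t, (t - s) ^ (-(1 / 2 : ℝ)) * (ψ s * χ s)) ^ 2))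
    (hvm : Measurable (uncurry v)) (hvs : ∀ s, Continuous (v s))
    {D Xap : ℝ} (hD : ∀ s x, ‖v s x‖ ≤ D) (hXap0 : 0 ≤ Xap)
    (hXap : ∀ s (R : EuclideanSpace ℝ (Fin 3) ≃ₗᵢ[ℝ] EuclideanSpace ℝ (Fin 3)) (c : ℝ),
      ∫⁻ y : EuclideanSpace ℝ (Fin 2), ‖v s (R (toLp 2 ![y 0, y 1, c]))‖ₑ ^ 2 ≤ ENNReal.ofReal (Xap ^ 2))
    {S₁ τ : ℝ} (hτ : 0 < τ) (hτS : τ ≤ S₁)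
    (hrep : ∀ t, τ < t → t ≤ S₁ → ∀ x,
      v t x = UnboundedOperators.heatExtension (v τ) (t - τ) x - oseenDuhamel 1 τ v v t x)
    {ε η : ℝ} (hε : 0 < ε) (hη : 0 < η)
    (hXτ : ∀ (R : EuclideanSpace ℝ (Fin 3) ≃ₗᵢ[ℝ] EuclideanSpace ℝ (Fin 3)) (c : ℝ),
      ∫⁻ y : EuclideanSpace ℝ (Fin 2), ‖v τ (R (toLp 2 ![y 0, y 1, c]))‖ₑ ^ 2 ≤ ENNReal.ofReal ((3 / 2 * ε) ^ 2))
    (hΦτ : ∀ x, ‖v τ x‖ ≤ η / (2 * Real.sqrt τ)) :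
    ∃ δ : ℝ, 0 < δ ∧ ∀ t, τ < t → t ≤ τ + δ → t ≤ S₁ →
      (∀ (R : EuclideanSpace ℝ (Fin 3) ≃ₗᵢ[ℝ] EuclideanSpace ℝ (Fin 3)) (c : ℝ),
        ∫⁻ y : EuclideanSpace ℝ (Fin 2), ‖v t (R (toLp 2 ![y 0, y 1, c]))‖ₑ ^ 2 ≤ ENNReal.ofReal ((2 * ε) ^ 2)) ∧
      ∀ x, Real.sqrt t * ‖v t x‖ ≤ η := by
  set C₀ : ℝ := oseenSliceConst (EuclideanSpace ℝ (Fin 3)) with hC₀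
  have hC₀pos : 0 < C₀ := oseenSliceConst_pos
  have hD0 : 0 ≤ D := (norm_nonneg _).trans (hD 0 0)
  have hsτ : 0 < Real.sqrt τ := Real.sqrt_pos.2 hτ
  have hS₁ : 0 < S₁ := hτ.trans_le hτS
  have hsS : 0 < Real.sqrt S₁ := Real.sqrt_pos.2 hS₁
  -- the three smallness requirements on `δ`
  set δ₁ : ℝ := (ε / (4 * C₁ * D * Xap + 1)) ^ 2 with hδ₁
  set δ₂ : ℝ := (η / (8 * Real.sqrt S₁ * C₀ * D ^ 2 + 1)) ^ 2 with hδ₂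
  have hden₁ : 0 < 4 * C₁ * D * Xap + 1 := by positivity
  have hden₂ : 0 < 8 * Real.sqrt S₁ * C₀ * D ^ 2 + 1 := by positivity
  have hδ₁pos : 0 < δ₁ := by positivity
  have hδ₂pos : 0 < δ₂ := by positivity
  refine ⟨min (7 / 9 * τ) (min δ₁ δ₂), lt_min (by positivity) (lt_min hδ₁pos hδ₂pos), ?_⟩
  intro t hτt htδ htS
  have ht0 : 0 < t := hτ.trans hτt
  have hts : 0 < t - τ := sub_pos.2 hτt
  have hst : 0 < Real.sqrt t := Real.sqrt_pos.2 ht0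
  have hd1 : t - τ ≤ δ₁ := by linarith [min_le_right (7 / 9 * τ) (min δ₁ δ₂), min_le_left δ₁ δ₂]
  have hd2 : t - τ ≤ δ₂ := by linarith [min_le_right (7 / 9 * τ) (min δ₁ δ₂), min_le_right δ₁ δ₂]
  have hd0 : t - τ ≤ 7 / 9 * τ := by linarith [min_le_left (7 / 9 * τ) (min δ₁ δ₂)]
  have hsqrt_sub₁ : Real.sqrt (t - τ) ≤ ε / (4 * C₁ * D * Xap + 1) := by
    rw [← Real.sqrt_sq (by positivity : 0 ≤ ε / (4 * C₁ * D * Xap + 1))]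
    exact Real.sqrt_le_sqrt (hd1.trans_eq hδ₁)
  have hsqrt_sub₂ : Real.sqrt (t - τ) ≤ η / (8 * Real.sqrt S₁ * C₀ * D ^ 2 + 1) := by
    rw [← Real.sqrt_sq (by positivity : 0 ≤ η / (8 * Real.sqrt S₁ * C₀ * D ^ 2 + 1))]
    exact Real.sqrt_le_sqrt (hd2.trans_eq hδ₂)
  refine ⟨fun R c => ?_, fun x => ?_⟩
  · -- the planar bound from the base time `τ` with the crude majorants
    have hχ : ∀ s ∈ Ioo τ t, (0 : ℝ) ≤ (fun _ : ℝ => Xap) s := fun _ _ => hXap0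
    have hXs : ∀ s ∈ Ioo τ t, ∀ (R' : EuclideanSpace ℝ (Fin 3) ≃ₗᵢ[ℝ] EuclideanSpace ℝ (Fin 3)) (c' : ℝ),
        ∫⁻ y : EuclideanSpace ℝ (Fin 2), ‖v s (R' (toLp 2 ![y 0, y 1, c']))‖ₑ ^ 2 ≤
          ENNReal.ofReal ((fun _ : ℝ => Xap) s ^ 2) := fun s _ R' c' => hXap s R' c'
    have hψ : ∀ s ∈ Ioo τ t, ∀ x, ‖v s x‖ ≤ (fun _ : ℝ => D) s := fun s _ x => hD s x
    have hint : IntegrableOn (fun s => (t - s) ^ (-(1 / 2 : ℝ)) * ((fun _ : ℝ => D) s * (fun _ : ℝ => Xap) s))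
        (Ioo τ t) := by
      have h : IntegrableOn (fun s => (t - s) ^ (-(1 / 2 : ℝ)) * (D * Xap)) (Ioo τ t) :=
        (integrableOn_sub_rpow_Ioo (by norm_num)).mul_const _
      exact h
    have hmain := hC₁spec hvm hvs hτt (hrep t hτt htS) (by positivity : (0 : ℝ) ≤ 3 / 2 * ε) hXτ hχ hXs hψ
      hint R c
    refine hmain.trans (ENNReal.ofReal_le_ofReal ?_)
    have hJ : ∫ s in Ioo τ t, (t - s) ^ (-(1 / 2 : ℝ)) * ((fun _ : ℝ => D) s * (fun _ : ℝ => Xap) s) =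
        D * Xap * (2 * (t - τ) ^ (1 / 2 : ℝ)) := by
      simp only
      rw [integral_mul_const, setIntegral_Ioo_sub_rpow_neg_half hτt.le]
      ring
    rw [hJ, ← Real.sqrt_eq_rpow]
    have hsmall : C₁ * (D * Xap * (2 * Real.sqrt (t - τ))) ≤ ε / 2 := by
      have h1 : C₁ * (D * Xap * (2 * Real.sqrt (t - τ))) = (2 * C₁ * D * Xap) * Real.sqrt (t - τ) := by ring
      rw [h1]
      calc (2 * C₁ * D * Xap) * Real.sqrt (t - τ) ≤ (2 * C₁ * D * Xap) * (ε / (4 * C₁ * D * Xap + 1)) :=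
            mul_le_mul_of_nonneg_left hsqrt_sub₁ (by positivity)
        _ ≤ ε / 2 := by
            rw [mul_div_assoc', div_le_div_iff₀ hden₁ two_pos]
            nlinarith [mul_nonneg (mul_nonneg hC₁.le hD0) hXap0]
    have hnn : 0 ≤ 3 / 2 * ε + C₁ * (D * Xap * (2 * Real.sqrt (t - τ))) := by positivity
    exact pow_le_pow_left₀ hnn (by linarith) 2
  · -- the sup bound: heat `L^∞` contraction and the KNSS bound of the Duhamel term
    have hheat : ‖UnboundedOperators.heatExtension (v τ) (t - τ) x‖ ≤ η / (2 * Real.sqrt τ) :=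
      UnboundedOperators.norm_heatExtension_le hΦτ hts x
    have hduh : ‖oseenDuhamel 1 τ v v t x‖ ≤ C₀ * (D * D) * (2 * Real.sqrt (t - τ)) :=
      norm_oseenDuhamel_le_const hτt.le (fun s _ y => hD s y) (fun s _ y => hD s y) x
    have hsplit : ‖v t x‖ ≤ η / (2 * Real.sqrt τ) + C₀ * (D * D) * (2 * Real.sqrt (t - τ)) := by
      rw [hrep t hτt htS x]
      exact (norm_sub_le _ _).trans (add_le_add hheat hduh)
    -- `√t ≤ (4/3)√τ` and `√t ≤ (4/3)√S₁`
    have hst43 : Real.sqrt t ≤ 4 / 3 * Real.sqrt τ := by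
      have h1 : t ≤ (4 / 3) ^ 2 * τ := by nlinarith
      calc Real.sqrt t ≤ Real.sqrt ((4 / 3) ^ 2 * τ) := Real.sqrt_le_sqrt h1
        _ = 4 / 3 * Real.sqrt τ := by rw [Real.sqrt_mul (by positivity), Real.sqrt_sq (by positivity)]
    have hstS : Real.sqrt t ≤ 4 / 3 * Real.sqrt S₁ :=
      hst43.trans (mul_le_mul_of_nonneg_left (Real.sqrt_le_sqrt hτS) (by positivity))
    have hterm1 : Real.sqrt t * (η / (2 * Real.sqrt τ)) ≤ 2 / 3 * η := by
      rw [mul_div_assoc', div_le_iff₀ (by positivity)]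
      nlinarith [hst43, hη]
    have hterm2 : Real.sqrt t * (C₀ * (D * D) * (2 * Real.sqrt (t - τ))) ≤ η / 3 := by
      have h1 : Real.sqrt t * (C₀ * (D * D) * (2 * Real.sqrt (t - τ))) ≤
          (4 / 3 * Real.sqrt S₁) * (C₀ * (D * D) * (2 * (η / (8 * Real.sqrt S₁ * C₀ * D ^ 2 + 1)))) := by
        refine mul_le_mul hstS ?_ (by positivity) (by positivity)
        exact mul_le_mul_of_nonneg_left (mul_le_mul_of_nonneg_left hsqrt_sub₂ two_pos.le) (by positivity)
      refine h1.trans ?_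
      rw [show (4 / 3 * Real.sqrt S₁) * (C₀ * (D * D) * (2 * (η / (8 * Real.sqrt S₁ * C₀ * D ^ 2 + 1)))) =
        (8 * Real.sqrt S₁ * C₀ * D ^ 2) * η / (8 * Real.sqrt S₁ * C₀ * D ^ 2 + 1) / 3 by ring]
      rw [div_le_div_iff₀ three_pos three_pos, div_mul_eq_mul_div, div_le_iff₀ hden₂]
      nlinarith [mul_nonneg (mul_nonneg (mul_nonneg (by norm_num : (0:ℝ) ≤ 8) hsS.le) hC₀pos.le) (sq_nonneg D),
        hη.le]
    calc Real.sqrt t * ‖v t x‖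
        ≤ Real.sqrt t * (η / (2 * Real.sqrt τ) + C₀ * (D * D) * (2 * Real.sqrt (t - τ))) :=
          mul_le_mul_of_nonneg_left hsplit hst.le
      _ = Real.sqrt t * (η / (2 * Real.sqrt τ)) + Real.sqrt t * (C₀ * (D * D) * (2 * Real.sqrt (t - τ))) := by
          ring
      _ ≤ 2 / 3 * η + η / 3 := add_le_add hterm1 hterm2
      _ = η := by ring

/-- **Slack from the initial time.** Same as `slack_pos` from the base time `0`, where the datum has
planar energies `≤ ε²` and `‖v(0)‖ ≤ D`: the bounds "planar energies `≤ (2ε)²`, `√t ‖v(t)‖ ≤ η`" hold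
on `(0, δ]`, `t ≤ S₁`, for some `δ > 0`. [cite: KochNadirashviliSereginSverak2009, §4 p. 8] -/
theorem slack_zero {C₁ : ℝ} (hC₁ : 0 < C₁)
    (hC₁spec : ∀ {w : ℝ → EuclideanSpace ℝ (Fin 3) → EuclideanSpace ℝ (Fin 3)},
      Measurable (uncurry w) → (∀ s, Continuous (w s)) → ∀ {t₀ t : ℝ}, t₀ < t →
      (∀ x, w t x = UnboundedOperators.heatExtension (w t₀) (t - t₀) x - oseenDuhamel 1 t₀ w w t x) →
      ∀ {χ₀ : ℝ}, 0 ≤ χ₀ →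
      (∀ (R : EuclideanSpace ℝ (Fin 3) ≃ₗᵢ[ℝ] EuclideanSpace ℝ (Fin 3)) (c : ℝ),
        ∫⁻ y : EuclideanSpace ℝ (Fin 2), ‖w t₀ (R (toLp 2 ![y 0, y 1, c]))‖ₑ ^ 2 ≤ ENNReal.ofReal (χ₀ ^ 2)) →
      ∀ {χ ψ : ℝ → ℝ}, (∀ s ∈ Ioo t₀ t, 0 ≤ χ s) →
      (∀ s ∈ Ioo t₀ t, ∀ (R : EuclideanSpace ℝ (Fin 3) ≃ₗᵢ[ℝ] EuclideanSpace ℝ (Fin 3)) (c : ℝ),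
        ∫⁻ y : EuclideanSpace ℝ (Fin 2), ‖w s (R (toLp 2 ![y 0, y 1, c]))‖ₑ ^ 2 ≤ ENNReal.ofReal (χ s ^ 2)) →
      (∀ s ∈ Ioo t₀ t, ∀ x, ‖w s x‖ ≤ ψ s) →
      IntegrableOn (fun s => (t - s) ^ (-(1 / 2 : ℝ)) * (ψ s * χ s)) (Ioo t₀ t) →
      ∀ (R : EuclideanSpace ℝ (Fin 3) ≃ₗᵢ[ℝ] EuclideanSpace ℝ (Fin 3)) (c : ℝ),
        ∫⁻ y : EuclideanSpace ℝ (Fin 2), ‖w t (R (toLp 2 ![y 0, y 1, c]))‖ₑ ^ 2 ≤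
          ENNReal.ofReal ((χ₀ + C₁ * ∫ s in Ioo t₀ t, (t - s) ^ (-(1 / 2 : ℝ)) * (ψ s * χ s)) ^ 2))
    (hvm : Measurable (uncurry v)) (hvs : ∀ s, Continuous (v s))
    {D Xap : ℝ} (hD : ∀ s x, ‖v s x‖ ≤ D) (hXap0 : 0 ≤ Xap)
    (hXap : ∀ s (R : EuclideanSpace ℝ (Fin 3) ≃ₗᵢ[ℝ] EuclideanSpace ℝ (Fin 3)) (c : ℝ),
      ∫⁻ y : EuclideanSpace ℝ (Fin 2), ‖v s (R (toLp 2 ![y 0, y 1, c]))‖ₑ ^ 2 ≤ ENNReal.ofReal (Xap ^ 2))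
    {S₁ : ℝ}
    (hrep : ∀ t, 0 < t → t ≤ S₁ → ∀ x,
      v t x = UnboundedOperators.heatExtension (v 0) (t - 0) x - oseenDuhamel 1 0 v v t x)
    {ε η : ℝ} (hε : 0 < ε) (hη : 0 < η)
    (hX0 : ∀ (R : EuclideanSpace ℝ (Fin 3) ≃ₗᵢ[ℝ] EuclideanSpace ℝ (Fin 3)) (c : ℝ),
      ∫⁻ y : EuclideanSpace ℝ (Fin 2), ‖v 0 (R (toLp 2 ![y 0, y 1, c]))‖ₑ ^ 2 ≤ ENNReal.ofReal (ε ^ 2)) :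
    ∃ δ : ℝ, 0 < δ ∧ ∀ t, 0 < t → t ≤ δ → t ≤ S₁ →
      (∀ (R : EuclideanSpace ℝ (Fin 3) ≃ₗᵢ[ℝ] EuclideanSpace ℝ (Fin 3)) (c : ℝ),
        ∫⁻ y : EuclideanSpace ℝ (Fin 2), ‖v t (R (toLp 2 ![y 0, y 1, c]))‖ₑ ^ 2 ≤ ENNReal.ofReal ((2 * ε) ^ 2)) ∧
      ∀ x, Real.sqrt t * ‖v t x‖ ≤ η := by
  set C₀ : ℝ := oseenSliceConst (EuclideanSpace ℝ (Fin 3)) with hC₀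
  have hC₀pos : 0 < C₀ := oseenSliceConst_pos
  have hD0 : 0 ≤ D := (norm_nonneg _).trans (hD 0 0)
  set δ₁ : ℝ := (ε / (2 * C₁ * D * Xap + 1)) ^ 2 with hδ₁
  set δ₂ : ℝ := (η / (D + 2 * C₀ * D ^ 2 + 1)) ^ 2 with hδ₂
  have hden₁ : 0 < 2 * C₁ * D * Xap + 1 := by positivity
  have hden₂ : 0 < D + 2 * C₀ * D ^ 2 + 1 := by positivity
  refine ⟨min 1 (min δ₁ δ₂), lt_min one_pos (lt_min (by positivity) (by positivity)), ?_⟩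
  intro t ht0 htδ _
  have hst : 0 < Real.sqrt t := Real.sqrt_pos.2 ht0
  have ht1 : t ≤ 1 := htδ.trans (min_le_left _ _)
  have hd1 : t ≤ δ₁ := htδ.trans ((min_le_right _ _).trans (min_le_left _ _))
  have hd2 : t ≤ δ₂ := htδ.trans ((min_le_right _ _).trans (min_le_right _ _))
  have hsqrt₁ : Real.sqrt t ≤ ε / (2 * C₁ * D * Xap + 1) := by
    rw [← Real.sqrt_sq (by positivity : 0 ≤ ε / (2 * C₁ * D * Xap + 1))]
    exact Real.sqrt_le_sqrt (hd1.trans_eq hδ₁)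
  have hsqrt₂ : Real.sqrt t ≤ η / (D + 2 * C₀ * D ^ 2 + 1) := by
    rw [← Real.sqrt_sq (by positivity : 0 ≤ η / (D + 2 * C₀ * D ^ 2 + 1))]
    exact Real.sqrt_le_sqrt (hd2.trans_eq hδ₂)
  have hsqrt1 : Real.sqrt t ≤ 1 := by
    rw [← Real.sqrt_one]; exact Real.sqrt_le_sqrt ht1
  refine ⟨fun R c => ?_, fun x => ?_⟩
  · have hχ : ∀ s ∈ Ioo 0 t, (0 : ℝ) ≤ (fun _ : ℝ => Xap) s := fun _ _ => hXap0
    have hXs : ∀ s ∈ Ioo 0 t, ∀ (R' : EuclideanSpace ℝ (Fin 3) ≃ₗᵢ[ℝ] EuclideanSpace ℝ (Fin 3)) (c' : ℝ),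
        ∫⁻ y : EuclideanSpace ℝ (Fin 2), ‖v s (R' (toLp 2 ![y 0, y 1, c']))‖ₑ ^ 2 ≤
          ENNReal.ofReal ((fun _ : ℝ => Xap) s ^ 2) := fun s _ R' c' => hXap s R' c'
    have hψ : ∀ s ∈ Ioo 0 t, ∀ x, ‖v s x‖ ≤ (fun _ : ℝ => D) s := fun s _ x => hD s x
    have hint : IntegrableOn (fun s => (t - s) ^ (-(1 / 2 : ℝ)) * ((fun _ : ℝ => D) s * (fun _ : ℝ => Xap) s))
        (Ioo 0 t) := by
      have h : IntegrableOn (fun s => (t - s) ^ (-(1 / 2 : ℝ)) * (D * Xap)) (Ioo 0 t) :=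
        (integrableOn_sub_rpow_Ioo (by norm_num)).mul_const _
      exact h
    have hmain := hC₁spec hvm hvs ht0 (hrep t ht0 ‹t ≤ S₁›) hε.le hX0 hχ hXs hψ hint R c
    refine hmain.trans (ENNReal.ofReal_le_ofReal ?_)
    have hJ : ∫ s in Ioo 0 t, (t - s) ^ (-(1 / 2 : ℝ)) * ((fun _ : ℝ => D) s * (fun _ : ℝ => Xap) s) =
        D * Xap * (2 * (t - 0) ^ (1 / 2 : ℝ)) := by
      simp only
      rw [integral_mul_const, setIntegral_Ioo_sub_rpow_neg_half ht0.le]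
      ring
    rw [hJ, sub_zero, ← Real.sqrt_eq_rpow]
    have hsmall : C₁ * (D * Xap * (2 * Real.sqrt t)) ≤ ε := by
      have h1 : C₁ * (D * Xap * (2 * Real.sqrt t)) = (2 * C₁ * D * Xap) * Real.sqrt t := by ring
      rw [h1]
      calc (2 * C₁ * D * Xap) * Real.sqrt t ≤ (2 * C₁ * D * Xap) * (ε / (2 * C₁ * D * Xap + 1)) :=
            mul_le_mul_of_nonneg_left hsqrt₁ (by positivity)
        _ ≤ ε := by
            rw [mul_div_assoc', div_le_iff₀ hden₁]
            nlinarith [mul_nonneg (mul_nonneg hC₁.le hD0) hXap0, hε.le]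
    have hnn : 0 ≤ ε + C₁ * (D * Xap * (2 * Real.sqrt t)) := by positivity
    exact pow_le_pow_left₀ hnn (by linarith) 2
  · have hheat : ‖UnboundedOperators.heatExtension (v 0) (t - 0) x‖ ≤ D := by
      rw [sub_zero]
      exact UnboundedOperators.norm_heatExtension_le (hD 0) ht0 x
    have hduh : ‖oseenDuhamel 1 0 v v t x‖ ≤ C₀ * (D * D) * (2 * Real.sqrt (t - 0)) :=
      norm_oseenDuhamel_le_const ht0.le (fun s _ y => hD s y) (fun s _ y => hD s y) x
    rw [sub_zero] at hduh
    have hsplit : ‖v t x‖ ≤ D + C₀ * (D * D) * (2 * Real.sqrt t) := by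
      rw [hrep t ht0 ‹t ≤ S₁› x]
      exact (norm_sub_le _ _).trans (add_le_add hheat hduh)
    calc Real.sqrt t * ‖v t x‖ ≤ Real.sqrt t * (D + C₀ * (D * D) * (2 * Real.sqrt t)) :=
          mul_le_mul_of_nonneg_left hsplit hst.le
      _ ≤ Real.sqrt t * (D + 2 * C₀ * D ^ 2 + 1) := by
          refine mul_le_mul_of_nonneg_left ?_ hst.le
          nlinarith [mul_nonneg hC₀pos.le (sq_nonneg D), hsqrt1]
      _ ≤ (η / (D + 2 * C₀ * D ^ 2 + 1)) * (D + 2 * C₀ * D ^ 2 + 1) :=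
          mul_le_mul_of_nonneg_right hsqrt₂ hden₂.le
      _ = η := by field_simp

/-! ### Closedness: the bounds pass to the limit `τ' ↑ τ` -/

/-- **Closedness of the trapped set.** If `v` is jointly continuous and the bounds "planar energies
`≤ (2ε)²`, `√s ‖v(s)‖ ≤ η`" hold on `(0, τ']` for every `τ' < τ` (`τ > 0`), they hold on `(0, τ]`
(Fatou's lemma along `τ_n ↑ τ` for the planar energies, continuity for the velocity). [folklore] -/
theorem closed (hvc : Continuous (uncurry v)) {ε η τ : ℝ} (hτ : 0 < τ)
    (h : ∀ τ' ∈ Ioo 0 τ,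
      (∀ s ∈ Ioc 0 τ', ∀ (R : EuclideanSpace ℝ (Fin 3) ≃ₗᵢ[ℝ] EuclideanSpace ℝ (Fin 3)) (c : ℝ),
        ∫⁻ y : EuclideanSpace ℝ (Fin 2), ‖v s (R (toLp 2 ![y 0, y 1, c]))‖ₑ ^ 2 ≤ ENNReal.ofReal ((2 * ε) ^ 2)) ∧
      ∀ s ∈ Ioc 0 τ', ∀ x, Real.sqrt s * ‖v s x‖ ≤ η) :
    (∀ s ∈ Ioc 0 τ, ∀ (R : EuclideanSpace ℝ (Fin 3) ≃ₗᵢ[ℝ] EuclideanSpace ℝ (Fin 3)) (c : ℝ),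
        ∫⁻ y : EuclideanSpace ℝ (Fin 2), ‖v s (R (toLp 2 ![y 0, y 1, c]))‖ₑ ^ 2 ≤ ENNReal.ofReal ((2 * ε) ^ 2)) ∧
      ∀ s ∈ Ioc 0 τ, ∀ x, Real.sqrt s * ‖v s x‖ ≤ η := by
  -- values strictly before `τ`
  have hbefore_X : ∀ s ∈ Ioo 0 τ, ∀ (R : EuclideanSpace ℝ (Fin 3) ≃ₗᵢ[ℝ] EuclideanSpace ℝ (Fin 3)) (c : ℝ),
      ∫⁻ y : EuclideanSpace ℝ (Fin 2), ‖v s (R (toLp 2 ![y 0, y 1, c]))‖ₑ ^ 2 ≤ ENNReal.ofReal ((2 * ε) ^ 2) :=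
    fun s hs => (h s hs).1 s ⟨hs.1, le_rfl⟩
  have hbefore_Φ : ∀ s ∈ Ioo 0 τ, ∀ x, Real.sqrt s * ‖v s x‖ ≤ η :=
    fun s hs => (h s hs).2 s ⟨hs.1, le_rfl⟩
  -- an increasing sequence `τ_n ↑ τ` inside `(0, τ)`
  set sq : ℕ → ℝ := fun n => τ * (1 - 1 / ((n : ℝ) + 2)) with hsq
  have hsq_mem : ∀ n, sq n ∈ Ioo 0 τ := by
    intro n
    have hn : (0 : ℝ) < (n : ℝ) + 2 := by positivity
    have h1 : 0 < 1 - 1 / ((n : ℝ) + 2) := by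
      rw [sub_pos, div_lt_one hn]; linarith
    have h2 : 1 - 1 / ((n : ℝ) + 2) < 1 := by
      have : 0 < 1 / ((n : ℝ) + 2) := by positivity
      linarith
    exact ⟨mul_pos hτ h1, by nlinarith⟩
  have hsq_tend : Tendsto sq atTop (𝓝 τ) := by
    have h1 : Tendsto (fun n : ℕ => 1 / ((n : ℝ) + 2)) atTop (𝓝 0) := by
      have := (tendsto_one_div_add_atTop_nhds_zero_nat (𝕜 := ℝ)).comp (tendsto_add_atTop_nat 1)
      refine this.congr fun n => ?_
      simp only [Function.comp_apply, Nat.cast_add, Nat.cast_one]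
      ring
    have h2 : Tendsto (fun n : ℕ => τ * (1 - 1 / ((n : ℝ) + 2))) atTop (𝓝 (τ * (1 - 0))) :=
      (tendsto_const_nhds (x := τ)).mul ((tendsto_const_nhds (x := (1 : ℝ))).sub h1)
    rwa [sub_zero, mul_one] at h2
  refine ⟨fun s hs R c => ?_, fun s hs x => ?_⟩
  · rcases hs.2.lt_or_eq with hlt | heq
    · exact hbefore_X s ⟨hs.1, hlt⟩ R c
    subst heq
    -- Fatou along `sq`
    set Pl : EuclideanSpace ℝ (Fin 2) → EuclideanSpace ℝ (Fin 3) := fun y => R (toLp 2 ![y 0, y 1, c]) with hPl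
    have hPlc : Continuous Pl := continuous_plane R c
    have hptw : ∀ y, Tendsto (fun n => (‖v (sq n) (Pl y)‖ₑ) ^ 2) atTop (𝓝 ((‖v s (Pl y)‖ₑ) ^ 2)) := by
      intro y
      have hc : Tendsto (fun n => v (sq n) (Pl y)) atTop (𝓝 (v s (Pl y))) := by
        have h1 : Tendsto (fun n => ((sq n, Pl y) : ℝ × EuclideanSpace ℝ (Fin 3))) atTop (𝓝 (s, Pl y)) :=
          hsq_tend.prodMk_nhds tendsto_const_nhds
        exact (hvc.tendsto (s, Pl y)).comp h1
      exact ((ENNReal.continuous_pow 2).tendsto _).comp ((continuous_enorm.tendsto _).comp hc)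
    have hmeas : ∀ n, Measurable fun y => (‖v (sq n) (Pl y)‖ₑ) ^ 2 := fun n =>
      ((hvc.comp (continuous_const.prodMk hPlc)).measurable.enorm).pow_const 2
    calc ∫⁻ y, ‖v s (Pl y)‖ₑ ^ 2 = ∫⁻ y, liminf (fun n => (‖v (sq n) (Pl y)‖ₑ) ^ 2) atTop := by
          refine lintegral_congr fun y => ?_
          exact ((hptw y).liminf_eq).symm
      _ ≤ liminf (fun n => ∫⁻ y, (‖v (sq n) (Pl y)‖ₑ) ^ 2) atTop := lintegral_liminf_le hmeas
      _ ≤ ENNReal.ofReal ((2 * ε) ^ 2) := by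
          refine liminf_le_of_frequently_le' (Frequently.of_forall fun n => ?_)
          exact hbefore_X (sq n) (hsq_mem n) R c
  · rcases hs.2.lt_or_eq with hlt | heq
    · exact hbefore_Φ s ⟨hs.1, hlt⟩ x
    subst heq
    -- continuity along `sq`
    have hc : Tendsto (fun n => Real.sqrt (sq n) * ‖v (sq n) x‖) atTop (𝓝 (Real.sqrt s * ‖v s x‖)) := by
      have h1 : Tendsto (fun n => ((sq n, x) : ℝ × EuclideanSpace ℝ (Fin 3))) atTop (𝓝 (s, x)) :=
        hsq_tend.prodMk_nhds tendsto_const_nhds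
      have h2 : Tendsto (fun n => ‖v (sq n) x‖) atTop (𝓝 ‖v s x‖) :=
        (continuous_norm.tendsto _).comp ((hvc.tendsto (s, x)).comp h1)
      exact ((Real.continuous_sqrt.tendsto _).comp hsq_tend).mul h2
    exact le_of_tendsto' hc fun n => hbefore_Φ (sq n) (hsq_mem n) x

end Setting

/-! ### Registered form -/

/-- **Closedness of the trapped set, closed form** (registered sub-goal of
stmt-NavierStokesRegularity-16855): the statement of `closed` for an explicitly quantified field.
[folklore] -/
theorem closed_closedForm :
    ∀ (v : ℝ → EuclideanSpace ℝ (Fin 3) → EuclideanSpace ℝ (Fin 3)), Continuous (Function.uncurry v) →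
      ∀ (ε η τ : ℝ), 0 < τ →
      (∀ τ' ∈ Set.Ioo 0 τ,
        (∀ s ∈ Set.Ioc 0 τ', ∀ (R : EuclideanSpace ℝ (Fin 3) ≃ₗᵢ[ℝ] EuclideanSpace ℝ (Fin 3)) (c : ℝ),
          ∫⁻ y : EuclideanSpace ℝ (Fin 2), ‖v s (R (WithLp.toLp 2 ![y 0, y 1, c]))‖ₑ ^ 2 ≤
            ENNReal.ofReal ((2 * ε) ^ 2)) ∧
        ∀ s ∈ Set.Ioc 0 τ', ∀ x, Real.sqrt s * ‖v s x‖ ≤ η) →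
      (∀ s ∈ Set.Ioc 0 τ, ∀ (R : EuclideanSpace ℝ (Fin 3) ≃ₗᵢ[ℝ] EuclideanSpace ℝ (Fin 3)) (c : ℝ),
          ∫⁻ y : EuclideanSpace ℝ (Fin 2), ‖v s (R (WithLp.toLp 2 ![y 0, y 1, c]))‖ₑ ^ 2 ≤
            ENNReal.ofReal ((2 * ε) ^ 2)) ∧
        ∀ s ∈ Set.Ioc 0 τ, ∀ x, Real.sqrt s * ‖v s x‖ ≤ η :=
  fun _ hvc _ _ _ hτ h => closed hvc hτ h

end Summit.NavierStokesRegularity.NavierStokesRegularity.Theorems.PlanarEnergyAPriori.SmallData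

end
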